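import Summits.Ventures.CertifiedManyBodySolver.Certificates.HubbardSquare_cellword_KitSheet
import HarnessLib

/-!
# Ventures/CertifiedManyBodySolver — Certificates/HubbardSquare_cellword_KitImg.lean (hubbard-box-eng-2 g5, cell hubbard-fast)

HONEST FRAMING: transport bookkeeping of certified ground-state-energy bounds; not a superconductivity verdict; not a
pairing bound; no number is certified in this file — it holds two GENERIC composition lemmas used by the POINTWISE
(multilinear) census-cell words on nodes that carry a POINT floor but no n-sheet (the particle–hole IMAGE columns
`t' > 0` of the electron-doped materials, eng fs3-newnodes): a point floor `L ≤ e(t′,U,n₁)` at the anchor density is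
turned into a ONE-SIDED density-affine floor ("half-sheet") by convexity of `n ↦ e(t′,U,n)`
(`energyDensityTT'_ge_density_extrapolate_right/left`):
* `cell_point_halfsheet_right` — to the right of the anchor, through the vacuum `e(t′,U,0) ≤ 0`: `(L/n₁)·m ≤ e(t′,U,m)` for `n₁ ≤ m < 2`;
* `cell_point_halfsheet_left` — to the left of the anchor, through a cap `e(t′,U,n₃) ≤ R` at a higher density `n₃`:
  `L + (L − R) n₁/(n₃ − n₁) − ((L − R)/(n₃ − n₁))·m ≤ e(t′,U,m)` for `0 ≤ m ≤ n₁`.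
Both conclusions have the `A + B·m` shape consumed by `energyDensityTT'_box_ge` at `n = m` in the pointwise words.
-/

noncomputable section

namespace Summit.Ventures.CertifiedManyBodySolver.Certificates

open Matrix Finset Filter Topology
open Literature.MathematicalPhysics.QuantumLattice
open Literature.MathematicalPhysics.QuantumLattice.ThermodynamicLimit
open Literature.Probability.LatticeModels
open scoped ComplexOrder ComplexConjugate Topology BigOperators

/-- **Right half-sheet of a point floor (vacuum secant).** From `L ≤ e(t′,U,n₁)` at an anchor density `0 < n₁` and the vacuum
`e(t′,U,0) ≤ 0`: for every `n₁ ≤ m < 2`, `0 + (L/n₁)·m ≤ e(t′,U,m)` (convexity in the density: the secant through `(0, 0)` and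
`(n₁, L)` extended to the right). [cite: Ruelle1969, §3.3] -/
theorem cell_point_halfsheet_right {t' U L n₁ : ℝ} (hU : 0 ≤ U) (hn₁ : 0 < n₁)
    (hL : L ≤ energyDensityTT' 1 t' U n₁) :
    ∀ m : ℝ, n₁ ≤ m → m < 2 → (0 : ℝ) + L / n₁ * m ≤ energyDensityTT' 1 t' U m := by
  intro m h₁ h₂
  have hn : n₁ ≠ 0 := hn₁.ne'
  rcases eq_or_lt_of_le h₁ with h | h
  · subst h
    have e : (0 : ℝ) + L / n₁ * n₁ = L := by field_simp; ring
    rw [e]; exact hL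
  · have hx := energyDensityTT'_ge_density_extrapolate_right 1 t' hU (n₀ := 0) (n₁ := n₁) (n := m) (R₀ := 0)
      (L₁ := L) le_rfl hn₁ h h₂ (energyDensityTT'_density_zero_le 1 t' hU) hL
    have e : L + (L - 0) * (m - n₁) / (n₁ - 0) = (0 : ℝ) + L / n₁ * m := by field_simp; ring
    rw [e] at hx; exact hx

/-- **Left half-sheet of a point floor (cap secant).** From `L ≤ e(t′,U,n₁)`, a cap `e(t′,U,n₃) ≤ R` at a higher density
`n₁ < n₃ < 2`: for every `0 ≤ m ≤ n₁`, `(L + (L − R) n₁/(n₃ − n₁)) + (−((L − R)/(n₃ − n₁)))·m ≤ e(t′,U,m)` (convexity in the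
density: the secant through `(n₁, L)` and `(n₃, R)` extended to the left). [cite: Ruelle1969, §3.3] -/
theorem cell_point_halfsheet_left {t' U L R n₁ n₃ : ℝ} (hU : 0 ≤ U) (h₁₃ : n₁ < n₃) (hn₃ : n₃ < 2)
    (hL : L ≤ energyDensityTT' 1 t' U n₁) (hR : energyDensityTT' 1 t' U n₃ ≤ R) :
    ∀ m : ℝ, 0 ≤ m → m ≤ n₁ →
      (L + (L - R) * n₁ / (n₃ - n₁)) + (-((L - R) / (n₃ - n₁))) * m ≤ energyDensityTT' 1 t' U m := by
  intro m h₀ h₁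
  have hd : n₃ - n₁ ≠ 0 := by linarith
  rcases eq_or_lt_of_le h₁ with h | h
  · subst h
    have e : (L + (L - R) * m / (n₃ - m)) + (-((L - R) / (n₃ - m))) * m = L := by field_simp; ring
    rw [e]; exact hL
  · have hx := energyDensityTT'_ge_density_extrapolate_left 1 t' hU (n := m) (n₁ := n₁) (n₀ := n₃) (R₀ := R)
      (L₁ := L) h₀ h h₁₃ hn₃ hR hL
    have e : L + (L - R) * (n₁ - m) / (n₃ - n₁) =
        (L + (L - R) * n₁ / (n₃ - n₁)) + (-((L - R) / (n₃ - n₁))) * m := by field_simp; ring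
    rw [e] at hx; exact hx

end Summit.Ventures.CertifiedManyBodySolver.Certificates

end
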